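import Literature.NumberTheory.EllipticCurves.GaloisImageLiftingLevelPSquaredProofs
import Summits.BirchSwinnertonDyer.BirchSwinnertonDyer.Theorems.UniversalToricDescentLevelNineSaturation
import HarnessLib

/-!
# `ρ̄_{E,3}` onto and ONE non-scalar element of `Gal(ℚ(E[9])/ℚ(E[3]))` ⟹ `ρ̄_{E,3ⁿ}` onto for all `n`

Route `UniversalToricDescent` (BirchSwinnertonDyer), `--supports` crux stmt-BirchSwinnertonDyer-20695
`TwinSplitIMCAtThreeGoodSS` / its `a₃ = 0` re-key 23594: the one MATHEMATICAL `p = 3` delta of the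
`⊇`-half port (Howard 2004 Thm. B and Castella–Wan 2024 Thm. 5.12 assume the `3`-ADIC image of
`Gal(K̄/K)` is `GL₂(ℤ₃)`; the crux only carries «`ρ̄_{W′,3}` onto»; at `p ≥ 5` Serre bridges the two,
at `p = 3` he does not — seat memo SUPSET-AT3-v8 §1(d), utd-idea LENS-MEMO v13 §1). Namespace
`Summit.BirchSwinnertonDyer.BirchSwinnertonDyer.Theorems.LevelNine`. Theorems only: **no definition
and no named fact is introduced.** This is the `p = 3` companion of
`BSDSelmerPConverseSerreProofs` (`serre_hasSurjectiveModNGaloisRep_pow_holds`: for `p ≥ 5`, onto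
mod `p` ⟹ onto mod `p^n`) and of `GaloisImageLiftingLevelPSquaredProofs` (onto mod `9` ⟹ onto mod
`3^n`). At `p = 3`, onto mod `3` does NOT imply onto mod `9` (Elkies, arXiv:math/0612734: the curves
with `j = 4374, 419904, -44789760, …`; Dokchitser–Dokchitser, Math. Z. 272 (2012), Introduction);
the missing ingredient is exactly ONE element of `Γ_ℚ` acting trivially on `E[3]` and not as a
scalar on `E[9]` (group theory: `LevelNine.generalLinearGroup_nine_eq_top_of_nonscalar`, the
level-`9` saturation theorem; determinant: `det ρ̄_{E,9} = χ₉` by the Weil pairing,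
`det_eq_modNCyclotomicCharacter`, onto over `ℚ` by `modNCyclotomicCharacter_rat_surjective`).

* `hasSurjectiveModNGaloisRep_nine_of_three_of_nonscalar` — `E/ℚ` elliptic, `ρ̄_{E,3}` onto,
  `σ ∈ Γ_ℚ` with `σ • P = P` on `E[3]` and `σ` not a homothety on `E[9]` ⟹ `ρ̄_{E,9}` onto.
* `hasSurjectiveModNGaloisRep_three_pow_of_three_of_nonscalar` — hence `ρ̄_{E,3ⁿ}` onto for every `n`.

Where such a `σ` comes from (NOT proved here; recorded for users): for `E` semistable at a prime
`ℓ` with `3 ∤ v_ℓ(Δ_E)` the Tate curve gives an inertia element acting on `T₃E` as a transvection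
`≡ 1 (mod 3)`, `≢ 1 (mod 9)`; for `E` good supersingular at `3` with `a₃ = 0` the formal group is
Lubin–Tate of height `2` for `ℚ₉` and wild inertia at `3` acts on `E[9]` through
`(𝒪_{ℚ₉}/9)ˣ ⊃ 1 + 3𝒪_{ℚ₉}/9 ≅ 𝔽₉`, whose elements outside `𝔽₃` are non-scalar. This is the
`3`-adic-image input («`Gal(K̄/K) → Aut_{ℤ₃}(T)` onto») of the Heegner-point Kolyvagin-system
literature at `p = 3` (Howard 2004, Thm. B; Castella–Wan 2024, §5.4), which for `p ≥ 5` is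
automatic from mod-`p` surjectivity. BSD is not proved by any of this.

## References

* [SerreAbelianLadic1968] J.-P. Serre, *Abelian `ℓ`-adic representations and elliptic curves*
  (1968), Ch. IV §3.4, Lemma 3 and Exercises.
* [Elkies2006ThreeAdic] N. D. Elkies, arXiv:math/0612734 (2006), §0–§1.
* [DokchitserDokchitserMathZ2012] T. Dokchitser, V. Dokchitser, Math. Z. 272 (2012), Introduction.
* [SilvermanCSS1997] J. H. Silverman, in Cornell–Silverman–Stevens (1997), Ch. II §7–§8
  (`det ρ̄_m = χ_m`, Weil pairing) — used through `det_eq_modNCyclotomicCharacter`.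
-/

noncomputable section

open scoped MatrixGroups

set_option linter.dupNamespace false
set_option autoImplicit false

/-! ### Elliptic curves: `ρ̄_{E,3}` onto + one non-scalar element of the level-`3` kernel ⟹ `ρ̄_{E,3ⁿ}` onto -/

namespace Summit.BirchSwinnertonDyer.BirchSwinnertonDyer.Theorems.LevelNine

open WeierstrassCurve Matrix Literature.NumberTheory.EllipticCurves
  Literature.NumberTheory.GaloisRepresentations


/-- **`ρ̄_{E,3}` onto and ONE `σ ∈ Γ_ℚ` acting trivially on `E[3]` but not as a scalar on `E[9]`
⟹ `ρ̄_{E,9}` onto** (`E/ℚ` elliptic). The image `H ≤ GL₂(ℤ/9ℤ)` of the framed mod-`9`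
representation maps onto `GL₂(𝔽₃)` (hypothesis), has full determinant (`det ρ̄_{E,9} = χ₉` by the
Weil pairing, onto over `ℚ`), and contains the non-scalar kernel element `ρ̄_{E,9}(σ)`, so
`H = GL₂(ℤ/9ℤ)` by `LevelNine.generalLinearGroup_nine_eq_top_of_nonscalar`. At `p = 3` the
hypothesis on `σ` cannot be dropped: Elkies' curves (arXiv:math/0612734) are onto mod `3`, not
onto mod `9`, and their level-`3` kernel consists of scalars. Typical source of `σ`: an inertia
element at a prime `ℓ ∥ N_E` with `3 ∤ v_ℓ(Δ)` (Tate curve: a transvection `≡ 1 (mod 3)`), or wild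
inertia at `3` for good supersingular reduction with `a₃ = 0`. [cite: SerreAbelianLadic1968, Ch. IV §3.4, Lemma 3 and Exercises]
[cite: Elkies2006ThreeAdic, §0–§1] -/
theorem hasSurjectiveModNGaloisRep_nine_of_three_of_nonscalar (W : WeierstrassCurve ℚ)
    [W.IsElliptic] (hsurj : W.HasSurjectiveModNGaloisRep 3) (σ : Field.absoluteGaloisGroup ℚ)
    (h3 : ∀ P : geomTorsion W 3, σ • P = P)
    (h9 : ∀ c : ℤ, ∃ P : geomTorsion W 9, σ • P ≠ c • P) :
    W.HasSurjectiveModNGaloisRep 9 := by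
  have h3Q : ((3 : ℕ) : ℚ) ≠ 0 := by norm_num
  haveI : NeZero (3 ^ (1 + 1)) := ⟨by norm_num⟩
  haveI : NeZero (((3 ^ (1 + 1) : ℕ)) : ℚ) := ⟨by norm_num⟩
  -- frame `E[9] = E[3^(1+1)] ≅ (ℤ/9)²` and the framed representation `ρ`
  obtain ⟨e⟩ := nonempty_addEquiv_geomTorsion W 3 (1 + 1) (by norm_num) h3Q
  obtain ⟨ρ, hρ⟩ := exists_rep_of_addEquiv W e
  -- (i) the image maps onto `GL₂(𝔽₃)`
  have hπ : ∀ t : GL (Fin 2) (ZMod 3), ∃ h ∈ ρ.range, Matrix.GeneralLinearGroup.map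
      (ZMod.castHom three_dvd_nine (ZMod 3)) h = t := by
    intro t
    obtain ⟨τ, hτ⟩ := exists_map_eq_of_hasSurjectiveModNGaloisRep W 3 1 h3Q e ρ hρ hsurj t
    exact ⟨ρ τ, ⟨τ, rfl⟩, hτ⟩
  -- (ii) full determinant: `det ρ = χ₉` is onto over `ℚ`
  have hdet : ∀ v : (ZMod 9)ˣ, ∃ h ∈ ρ.range, Matrix.GeneralLinearGroup.det h = v := by
    intro v
    obtain ⟨τ, hτ⟩ := modNCyclotomicCharacter_rat_surjective (3 ^ (1 + 1)) v
    refine ⟨ρ τ, ⟨τ, rfl⟩, Units.ext ?_⟩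
    rw [Matrix.GeneralLinearGroup.val_det_apply, ← hτ]
    exact det_eq_modNCyclotomicCharacter W (3 ^ (1 + 1)) (by norm_num) e τ _ (hρ τ)
  -- (iii) `ρ σ` is `≡ 1 (mod 3)` …
  have hσ1 : Matrix.GeneralLinearGroup.map
      (ZMod.castHom three_dvd_nine (ZMod 3)) (ρ σ) = 1 := by
    obtain ⟨g₃, hg₃⟩ := exists_frame_torsion_of_frame_pow W 3 1 1 h3Q e ρ hρ
    have hv : ∀ v : Fin 2 → ZMod 3,
        ((Matrix.GeneralLinearGroup.map (ZMod.castHom (pow_dvd_pow 3 (Nat.le_add_right 1 1))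
          (ZMod (3 ^ 1))) (ρ σ) : GL (Fin 2) (ZMod (3 ^ 1))) :
            Matrix (Fin 2) (Fin 2) (ZMod (3 ^ 1))) *ᵥ v =
          ((1 : GL (Fin 2) (ZMod (3 ^ 1))) : Matrix (Fin 2) (Fin 2) (ZMod (3 ^ 1))) *ᵥ v := by
      intro v
      apply g₃.injective
      rw [← hg₃ σ v, Units.val_one, Matrix.one_mulVec]
      exact h3 (g₃ v)
    refine Units.ext (Matrix.ext fun i j ↦ ?_)
    have := congrFun (hv (Pi.single j 1)) i
    rwa [Matrix.mulVec_single_one, Matrix.mulVec_single_one] at this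
  -- … and not a scalar matrix
  have hns : ∀ k : ZMod 9, ((ρ σ : GL (Fin 2) (ZMod 9)) : Matrix (Fin 2) (Fin 2) (ZMod 9)) ≠
      k • (1 : Matrix (Fin 2) (Fin 2) (ZMod 9)) := by
    intro k hk
    obtain ⟨P, hP⟩ := h9 (k.val : ℤ)
    apply hP
    apply e.injective
    rw [hρ σ P, hk, Matrix.smul_mulVec, Matrix.one_mulVec, map_zsmul, natCast_zsmul,
      ← Nat.cast_smul_eq_nsmul (ZMod 9), ZMod.natCast_zmod_val]
  -- Level-`9` saturation: the image is everything
  have htop : ρ.range = ⊤ :=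
    generalLinearGroup_nine_eq_top_of_nonscalar ρ.range hπ hdet
      ⟨σ, rfl⟩ hσ1 hns
  exact hasSurjectiveModNGaloisRep_of_rep_surjective W e ρ hρ fun B ↦ by
    obtain ⟨τ, hτ⟩ : B ∈ ρ.range := htop ▸ Subgroup.mem_top B
    exact ⟨τ, hτ⟩

/-- **The `3`-adic tower**: under the same hypotheses `ρ̄_{E,3ⁿ}` is onto for EVERY `n`
(`hasSurjectiveModNGaloisRep_three_pow_of_nine`, Serre's lemma from level `9`). Over `ℚ` this
says: `ρ̄_{E,3}` onto and one non-scalar element of `Gal(ℚ(E[9])/ℚ(E[3]))` ⟹ `ρ_{E,3^∞}` onto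
`GL₂(ℤ₃)` at every finite level. [cite: SerreAbelianLadic1968, Ch. IV §3.4, Lemma 3 and Exercises]
[cite: Elkies2006ThreeAdic, §0] -/
theorem hasSurjectiveModNGaloisRep_three_pow_of_three_of_nonscalar (W : WeierstrassCurve ℚ)
    [W.IsElliptic] (hsurj : W.HasSurjectiveModNGaloisRep 3) (σ : Field.absoluteGaloisGroup ℚ)
    (h3 : ∀ P : geomTorsion W 3, σ • P = P)
    (h9 : ∀ c : ℤ, ∃ P : geomTorsion W 9, σ • P ≠ c • P) (n : ℕ) :
    W.HasSurjectiveModNGaloisRep ((3 ^ n : ℕ) : ℤ) :=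
  hasSurjectiveModNGaloisRep_three_pow_of_nine W (by norm_num)
    (hasSurjectiveModNGaloisRep_nine_of_three_of_nonscalar W hsurj σ h3 h9) n

end Summit.BirchSwinnertonDyer.BirchSwinnertonDyer.Theorems.LevelNine

/-! ### Over a general perfect field of characteristic `≠ 3` with `χ₉` onto (e.g. a number field
`K` with `K ∩ ℚ(ζ₉) = ℚ`, in particular an imaginary quadratic `K` in which `3` splits) -/

namespace Summit.BirchSwinnertonDyer.BirchSwinnertonDyer.Theorems.LevelNine

open WeierstrassCurve Matrix Literature.NumberTheory.EllipticCurves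
  Literature.NumberTheory.GaloisRepresentations

universe u

/-- **General base field.** For an elliptic curve `E` over a perfect field `F` with `3 ≠ 0` in
`F` whose mod-`9` cyclotomic character `χ₉ : Γ_F → (ℤ/9ℤ)ˣ` is onto (e.g. `F = ℚ`, or a number
field `K` linearly disjoint from `ℚ(ζ₉)` — every imaginary quadratic `K` in which `3` splits, the
fields of Howard 2004 Thm. B / Castella–Wan 2024 §5): `ρ̄_{E,3}` onto and ONE `σ ∈ Γ_F` trivial on
`E[3]` and not a homothety on `E[9]` ⟹ `ρ̄_{E,9}` onto. Same proof as over `ℚ`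
(`hasSurjectiveModNGaloisRep_nine_of_three_of_nonscalar`), with `χ₉` onto as a hypothesis in
place of `modNCyclotomicCharacter_rat_surjective`. [cite: SerreAbelianLadic1968, Ch. IV §3.4, Lemma 3 and Exercises]
[cite: Elkies2006ThreeAdic, §0–§1] -/
theorem hasSurjectiveModNGaloisRep_nine_of_three_of_nonscalar_of_cyclotomic {F : Type u}
    [Field F] [PerfectField F] [NeZero ((9 : ℕ) : F)] (W : WeierstrassCurve F) [W.IsElliptic]
    (h3F : (3 : F) ≠ 0) (hχ : Function.Surjective (modNCyclotomicCharacter F 9))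
    (hsurj : W.HasSurjectiveModNGaloisRep 3) (σ : Field.absoluteGaloisGroup F)
    (h3 : ∀ P : geomTorsion W 3, σ • P = P)
    (h9 : ∀ c : ℤ, ∃ P : geomTorsion W 9, σ • P ≠ c • P) :
    W.HasSurjectiveModNGaloisRep 9 := by
  have h3F' : ((3 : ℕ) : F) ≠ 0 := by exact_mod_cast h3F
  haveI : NeZero (3 ^ (1 + 1)) := ⟨by norm_num⟩
  haveI : NeZero (((3 ^ (1 + 1) : ℕ)) : F) := ⟨by
    have h := NeZero.ne ((9 : ℕ) : F)
    norm_num at h ⊢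
    exact h⟩
  obtain ⟨e⟩ := nonempty_addEquiv_geomTorsion W 3 (1 + 1) (by norm_num) h3F'
  obtain ⟨ρ, hρ⟩ := exists_rep_of_addEquiv W e
  have hπ : ∀ t : GL (Fin 2) (ZMod 3), ∃ h ∈ ρ.range, Matrix.GeneralLinearGroup.map
      (ZMod.castHom three_dvd_nine (ZMod 3)) h = t := by
    intro t
    obtain ⟨τ, hτ⟩ := exists_map_eq_of_hasSurjectiveModNGaloisRep W 3 1 h3F' e ρ hρ hsurj t
    exact ⟨ρ τ, ⟨τ, rfl⟩, hτ⟩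
  have hdet : ∀ v : (ZMod 9)ˣ, ∃ h ∈ ρ.range, Matrix.GeneralLinearGroup.det h = v := by
    intro v
    obtain ⟨τ, hτ⟩ := hχ v
    refine ⟨ρ τ, ⟨τ, rfl⟩, Units.ext ?_⟩
    rw [Matrix.GeneralLinearGroup.val_det_apply, ← hτ]
    exact det_eq_modNCyclotomicCharacter W (3 ^ (1 + 1)) (by norm_num) e τ _ (hρ τ)
  have hσ1 : Matrix.GeneralLinearGroup.map
      (ZMod.castHom three_dvd_nine (ZMod 3)) (ρ σ) = 1 := by
    obtain ⟨g₃, hg₃⟩ := exists_frame_torsion_of_frame_pow W 3 1 1 h3F' e ρ hρ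
    have hv : ∀ v : Fin 2 → ZMod 3,
        ((Matrix.GeneralLinearGroup.map (ZMod.castHom (pow_dvd_pow 3 (Nat.le_add_right 1 1))
          (ZMod (3 ^ 1))) (ρ σ) : GL (Fin 2) (ZMod (3 ^ 1))) :
            Matrix (Fin 2) (Fin 2) (ZMod (3 ^ 1))) *ᵥ v =
          ((1 : GL (Fin 2) (ZMod (3 ^ 1))) : Matrix (Fin 2) (Fin 2) (ZMod (3 ^ 1))) *ᵥ v := by
      intro v
      apply g₃.injective
      rw [← hg₃ σ v, Units.val_one, Matrix.one_mulVec]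
      exact h3 (g₃ v)
    refine Units.ext (Matrix.ext fun i j ↦ ?_)
    have := congrFun (hv (Pi.single j 1)) i
    rwa [Matrix.mulVec_single_one, Matrix.mulVec_single_one] at this
  have hns : ∀ k : ZMod 9, ((ρ σ : GL (Fin 2) (ZMod 9)) : Matrix (Fin 2) (Fin 2) (ZMod 9)) ≠
      k • (1 : Matrix (Fin 2) (Fin 2) (ZMod 9)) := by
    intro k hk
    obtain ⟨P, hP⟩ := h9 (k.val : ℤ)
    apply hP
    apply e.injective
    rw [hρ σ P, hk, Matrix.smul_mulVec, Matrix.one_mulVec, map_zsmul, natCast_zsmul,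
      ← Nat.cast_smul_eq_nsmul (ZMod 9), ZMod.natCast_zmod_val]
  have htop : ρ.range = ⊤ :=
    generalLinearGroup_nine_eq_top_of_nonscalar ρ.range hπ hdet ⟨σ, rfl⟩ hσ1 hns
  exact hasSurjectiveModNGaloisRep_of_rep_surjective W e ρ hρ fun B ↦ by
    obtain ⟨τ, hτ⟩ : B ∈ ρ.range := htop ▸ Subgroup.mem_top B
    exact ⟨τ, hτ⟩

/-- **General base field, every level**: under the hypotheses of
`hasSurjectiveModNGaloisRep_nine_of_three_of_nonscalar_of_cyclotomic`, `ρ̄_{E,3ⁿ}` is onto for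
every `n` (Serre's lemma from level `9`, `hasSurjectiveModNGaloisRep_three_pow_of_nine`).
[cite: SerreAbelianLadic1968, Ch. IV §3.4, Lemma 3 and Exercises] -/
theorem hasSurjectiveModNGaloisRep_three_pow_of_three_of_nonscalar_of_cyclotomic {F : Type u}
    [Field F] [PerfectField F] [NeZero ((9 : ℕ) : F)] (W : WeierstrassCurve F) [W.IsElliptic]
    (h3F : (3 : F) ≠ 0) (hχ : Function.Surjective (modNCyclotomicCharacter F 9))
    (hsurj : W.HasSurjectiveModNGaloisRep 3) (σ : Field.absoluteGaloisGroup F)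
    (h3 : ∀ P : geomTorsion W 3, σ • P = P)
    (h9 : ∀ c : ℤ, ∃ P : geomTorsion W 9, σ • P ≠ c • P) (n : ℕ) :
    W.HasSurjectiveModNGaloisRep ((3 ^ n : ℕ) : ℤ) :=
  hasSurjectiveModNGaloisRep_three_pow_of_nine W h3F
    (hasSurjectiveModNGaloisRep_nine_of_three_of_nonscalar_of_cyclotomic W h3F hχ hsurj σ h3 h9) n

end Summit.BirchSwinnertonDyer.BirchSwinnertonDyer.Theorems.LevelNine

end
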